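import Mathlib
import HarnessLib
import Summits.HubbardSuperconductivity.HubbardSuperconductivity.Theorems.KLProgrammeKLRegimeSplitFrameExtFnNumerals
import Summits.HubbardSuperconductivity.HubbardSuperconductivity.Theorems.KLProgrammeSalmhoferCutoffSecondDerivBound

/-!
# Route `KLProgramme` — ENGINE child 19918, two-leg slot: the LAST tier-1 cutoff numeral, `‖Dˡχ₂‖ ≤ 1110` for every `l ≤ 2`,
# and the order-2 numeral form of the G-extension bound

Cell `gate-hubbard-kl`, seat p1b (g7).  Every (E3a) tier-1 closer of the two-leg slot (`twoLegPieceV13_tier1_size_le_of_position_moments`,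
`twoLegPieceFn_eval_zero_tier1_size_le`, `twoLegCoreT_succ_of_position_exports_explicit/_stub`, …) carries one non-model binder
`hX : ∀ l ≤ 2, ∀ x, ‖iteratedFDeriv ℝ l salmhoferCutoff x‖ ≤ X`.  Orders `0, 1` are numerals in the tree (`|χ₂| ≤ 1`, `|χ₂′| ≤ 32/3`,
k3c2-p2 / k3c3-p1 `norm_iteratedFDeriv_salmhoferCutoff_le_of_le_one`); order `2` is k3c2-p3's `klsd_abs_deriv2_salmhoferCutoff_lt`
(`|χ₂″| < 1110`, `…SalmhoferCutoffSecondDerivBound`), so far unconsumed.  This file combines them: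

* **`norm_iteratedFDeriv_salmhoferCutoff_le_of_le_two`**: `‖Dˡχ₂(x)‖ ≤ 1110` for `l ≤ 2` — discharges `hX` with `X := 1110` in every tier-1 closer;
* **`norm_iteratedFDeriv_two_onM_klFrameExtFn_le`** (order `2`, numeral): `‖D² (onM (klFrameExtFn μ f)) q‖ ≤ 17760000000·G` for
  `G ≥ sup_{i ≤ 2} ‖Dⁱ(f − mean f)‖` (`(2!)²·(2·2!·1110·200²)·(4 + max 1 (1!/(8/5)))² = 4·177600000·25`);
* **`norm_iteratedFDeriv_onM_klFrameExtFn_le_tier1`**: the three tier-1 orders at once with `X := 1110`.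

Proofs only; nothing about the model is asserted.  References: BGM 2006 (2.36) [cite: BenfattoGiulianiMastropietro2006]; Salmhofer 1999 §4.2.5.
-/

noncomputable section

namespace Summit.HubbardSuperconductivity.HubbardSuperconductivity.Theorems.KLRegimeSplit

set_option linter.dupNamespace false -- summit = problem name (single-conjunct summit), D-0017

open Real Literature.MathematicalPhysics.QuantumLattice Literature.MathematicalPhysics.QuantumLattice.FermiRG

/-- **The tier-1 cutoff numeral**: `‖Dˡχ₂(x)‖ ≤ 1110` for every `l ≤ 2` and every `x` (`|χ₂| ≤ 1`, `|χ₂′| ≤ 32/3`, `|χ₂″| < 1110`). -/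
theorem norm_iteratedFDeriv_salmhoferCutoff_le_of_le_two {l : ℕ} (hl : l ≤ 2) (x : ℝ) :
    ‖iteratedFDeriv ℝ l salmhoferCutoff x‖ ≤ 1110 := by
  rcases Nat.lt_or_ge l 2 with h | h
  · exact (norm_iteratedFDeriv_salmhoferCutoff_le_of_le_one (by omega) x).trans (by norm_num)
  · obtain rfl : l = 2 := le_antisymm hl h
    rw [norm_iteratedFDeriv_eq_norm_iteratedDeriv, Real.norm_eq_abs, iteratedDeriv_succ, iteratedDeriv_one]
    exact (klsd_abs_deriv2_salmhoferCutoff_lt x).le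

/-- `1 ≤ 1110`: the numeral is a legitimate `X ≥ 1`. -/
theorem one_le_cutoffNumeralTier1 : (1 : ℝ) ≤ 1110 := by norm_num

section Order2

variable {f : ℝ → ℝ} {N : WithTop ℕ∞}

/-- **Order 2, numeral**: `‖D² (onM (klFrameExtFn μ f)) q‖ ≤ 17760000000·G` for `G ≥ sup_{i ≤ 2} ‖Dⁱ(f − mean f)‖` (`μ ∈ klWindowC`,
`f ∈ C^N`, `N ≥ 2`, `2π`-periodic). -/
theorem norm_iteratedFDeriv_two_onM_klFrameExtFn_le (hf : ContDiff ℝ N f) (hper : Function.Periodic f (2 * Real.pi))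
    (hN : (2 : WithTop ℕ∞) ≤ N) {G μ : ℝ} (hμ : μ ∈ klWindowC)
    (hG : ∀ i ≤ 2, ∀ t : ℝ, ‖iteratedFDeriv ℝ i (fun t => f t - klAngularMean f) t‖ ≤ G) (q : Momentum) :
    ‖iteratedFDeriv ℝ 2 (onM (klFrameExtFn μ f)) q‖ ≤ 17760000000 * G := by
  have h := norm_iteratedFDeriv_onM_klFrameExtFn_le hf hper (n := 2) (by exact_mod_cast hN) hμ hG
    (fun _ hl x => norm_iteratedFDeriv_salmhoferCutoff_le_of_le_two hl x) q
  have hG0 : 0 ≤ G := le_trans (norm_nonneg _) (hG 0 (Nat.zero_le _) 0)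
  have hmax : max (1 : ℝ) (((2 - 1).factorial : ℝ) / (8 / 5)) = 1 := by norm_num [Nat.factorial]
  rw [hmax] at h
  simp only [Nat.factorial, Nat.succ_eq_add_one, Nat.reduceAdd, Nat.reduceMul, Nat.cast_ofNat, show (2 : ℕ) ≠ 0 from two_ne_zero,
    if_false, zero_add] at h
  linarith

/-- **All three tier-1 orders with the numeral `X := 1110`**: for `n ≤ 2`,
`‖Dⁿ (onM (klFrameExtFn μ f)) q‖ ≤ [n = 0]·|mean f| + (n!)²·(2·n!·1110·200ⁿ)·G·(4 + max 1 ((n−1)!/(8/5)))ⁿ`. -/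
theorem norm_iteratedFDeriv_onM_klFrameExtFn_le_tier1 (hf : ContDiff ℝ N f) (hper : Function.Periodic f (2 * Real.pi)) {n : ℕ}
    (hn2 : n ≤ 2) (hn : (n : WithTop ℕ∞) ≤ N) {G μ : ℝ} (hμ : μ ∈ klWindowC)
    (hG : ∀ i ≤ n, ∀ t : ℝ, ‖iteratedFDeriv ℝ i (fun t => f t - klAngularMean f) t‖ ≤ G) (q : Momentum) :
    ‖iteratedFDeriv ℝ n (onM (klFrameExtFn μ f)) q‖ ≤
      (if n = 0 then |klAngularMean f| else 0) +
        (n.factorial : ℝ) ^ 2 * (2 * n.factorial * 1110 * 200 ^ n) * G * (4 + max 1 (((n - 1).factorial : ℝ) / (8 / 5))) ^ n :=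
  norm_iteratedFDeriv_onM_klFrameExtFn_le hf hper hn hμ hG (fun _ hl x => norm_iteratedFDeriv_salmhoferCutoff_le_of_le_two (hl.trans hn2) x) q

end Order2

end Summit.HubbardSuperconductivity.HubbardSuperconductivity.Theorems.KLRegimeSplit

end
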